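import Summits.Parity.GeneralizedHardyLittlewood.Theorems.LeeYangFibresAbsoluteUpgradeDipDefs
import HarnessLib

/-!
# Route `LeeYangFibres`, crux `AbsoluteUpgrade` (stmt-Parity-14116), line `dip-margin-rate-exchange`:
# the real-variable estimates of the Rouché budget (helpers for the stub `stub_pencilDiscOfChain`)

Helper file for the registered stub `stub_pencilDiscOfChain : PencilChainZero → ModGammaDisc → MarginPoly`
(file `LeeYangFibresAbsoluteUpgradePencilDisc.lean`).  Pure real inequalities, all with room to spare; the
variables are the rate `Λ = log(u-1) - γ`, the real parts `r = Re ζ` (the chain zero) and `s = Re z`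
(`|s - r| ≤ 1/(4Λ)`), the tilt size `t = |θ| ∈ [u^{-m}, 2]`, the Gamma bound `C ≥ 1`, the mod-Gamma constant
`C_K ≥ 1`; the Rouché margin is `δ = t/(8 C e^{Λ r})` and the size relation `e^{2Λ r} ≤ C² t` (from the chain
equation) is what makes the budget close:

* `pencilDisc_Lambda_facts` (registered helper) — for `u ≥ 64`: `Λ ≥ 2`, `log u ≤ 2Λ`, `log u ≤ Λ + 7/5`;
* `pencilDisc_consts` — the five constants are at most `B = 256 C³ C_K 9^{m+1} (m+3)^{m+3}` (so one
  threshold `u ≥ B` serves all estimates);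
* `pencilDisc_term1` — model error at `z`:  `(C_K/u) e^{s(Λ+γ)} ≤ δ/8` once `u ≥ 192 C³ C_K`;
* `pencilDisc_term2` — model error at `-z`: `t (C_K/u) e^{-s(Λ+γ)} ≤ δ/8` once `u ≥ 64 C C_K 3^{m+1}`;
* `pencilDisc_term3a` — relative coefficient error: `u^{-(m+4)} e^{(|s|+2) log u} ≤ δ/16` once
  `u ≥ 256 C²` and `u ≥ 128 C 9^{m+1}` (cases `s ≥ 0`: `e^{s log u} ≤ u`; `s < 0`:
  `e^{-s log u} ≤ e^{-Λ r} 9^{m+1}`);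
* `pencilDisc_ratio_pow_le`, `pencilDisc_term3b` — the floor: `u^{-u} · u (m+3)^u ≤ δ/16` once `u ≥ m + 3`
  and `u ≥ 256 C² (m+3)^{m+3}` (`((m+3)/u)^u ≤ ((m+3)/u)^{m+3}`).

Mathlib only (`Real.eulerMascheroniConstant_lt_two_thirds`, `Real.exp_one_lt_d9`, `Real.log_two_lt_d9`).
-/

noncomputable section

namespace Summit.Parity.GeneralizedHardyLittlewood.Cruxes.AbsoluteUpgrade.DipMarginRateExchange

open scoped BigOperators

/-- **The rate `Λ = log(u-1) - γ` for `u ≥ 64`**: `2 ≤ Λ`, `log u ≤ 2Λ`, `log u ≤ Λ + 7/5`, `0 ≤ log u`. -/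
theorem pencilDisc_Lambda_facts : ∀ (u : ℕ), 64 ≤ u → 2 ≤ Real.log ((u : ℝ) - 1) - Real.eulerMascheroniConstant ∧ Real.log u ≤ 2 * (Real.log ((u : ℝ) - 1) - Real.eulerMascheroniConstant) ∧ Real.log u ≤ Real.log ((u : ℝ) - 1) - Real.eulerMascheroniConstant + 7 / 5 ∧ 0 ≤ Real.log (u : ℝ) := by
  intro u hu
  have hγ : Real.eulerMascheroniConstant < 2 / 3 := Real.eulerMascheroniConstant_lt_two_thirds
  have hu64 : (64 : ℝ) ≤ u := by exact_mod_cast hu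
  have hl2 : Real.log 2 < 0.6931471808 := Real.log_two_lt_d9
  have hl2' : 0.6931471803 < Real.log 2 := Real.log_two_gt_d9
  have h64 : Real.log 64 = 6 * Real.log 2 := by
    rw [show (64 : ℝ) = 2 ^ 6 by norm_num, Real.log_pow]; norm_num
  have hlogu : 6 * Real.log 2 ≤ Real.log u := by
    rw [← h64]; exact Real.log_le_log (by norm_num) hu64
  -- `log (u - 1) ≥ log (u / 2) = log u - log 2`
  have hum1 : Real.log u - Real.log 2 ≤ Real.log ((u : ℝ) - 1) := by
    have h1 : Real.log ((u : ℝ) / 2) = Real.log u - Real.log 2 :=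
      Real.log_div (by linarith) (by norm_num)
    rw [← h1]
    exact Real.log_le_log (by positivity) (by linarith)
  refine ⟨by linarith, by linarith, by linarith, Real.log_nonneg (by linarith)⟩

/-- **The constants**: with `B = 256 C³ C_K 9^{m+1} (m+3)^{m+3}`, `C, C_K ≥ 1`, each constant of the five
estimates is at most `B`. -/
theorem pencilDisc_consts {C CK : ℝ} (hC : 1 ≤ C) (hCK : 1 ≤ CK) (m : ℕ) :
    192 * C ^ 3 * CK ≤ 256 * C ^ 3 * CK * 9 ^ (m + 1) * ((m : ℝ) + 3) ^ (m + 3) ∧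
      64 * C * CK * 3 ^ (m + 1) ≤ 256 * C ^ 3 * CK * 9 ^ (m + 1) * ((m : ℝ) + 3) ^ (m + 3) ∧
      256 * C ^ 2 ≤ 256 * C ^ 3 * CK * 9 ^ (m + 1) * ((m : ℝ) + 3) ^ (m + 3) ∧
      128 * C * 9 ^ (m + 1) ≤ 256 * C ^ 3 * CK * 9 ^ (m + 1) * ((m : ℝ) + 3) ^ (m + 3) ∧
      256 * C ^ 2 * ((m : ℝ) + 3) ^ (m + 3) ≤
        256 * C ^ 3 * CK * 9 ^ (m + 1) * ((m : ℝ) + 3) ^ (m + 3) := by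
  have h9 : (1 : ℝ) ≤ 9 ^ (m + 1) := one_le_pow₀ (by norm_num)
  have hM : (1 : ℝ) ≤ ((m : ℝ) + 3) ^ (m + 3) :=
    one_le_pow₀ (by linarith [(Nat.cast_nonneg m : (0 : ℝ) ≤ m)])
  have h39 : (3 : ℝ) ^ (m + 1) ≤ 9 ^ (m + 1) := pow_le_pow_left₀ (by norm_num) (by norm_num) _
  have hC3 : C ≤ C ^ 3 := by
    calc C = C * 1 * 1 := by ring
      _ ≤ C * C * C := by gcongr
      _ = C ^ 3 := by ring
  have hC23 : C ^ 2 ≤ C ^ 3 := by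
    calc C ^ 2 = C * C * 1 := by ring
      _ ≤ C * C * C := by gcongr
      _ = C ^ 3 := by ring
  have hC0 : 0 ≤ C := by linarith
  refine ⟨?_, ?_, ?_, ?_, ?_⟩
  · calc 192 * C ^ 3 * CK = 192 * C ^ 3 * CK * 1 * 1 := by ring
      _ ≤ 256 * C ^ 3 * CK * 9 ^ (m + 1) * ((m : ℝ) + 3) ^ (m + 3) := by gcongr; norm_num
  · calc 64 * C * CK * 3 ^ (m + 1) = 64 * C * CK * 3 ^ (m + 1) * 1 := by ring
      _ ≤ 256 * C ^ 3 * CK * 9 ^ (m + 1) * ((m : ℝ) + 3) ^ (m + 3) := by gcongr; norm_num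
  · calc 256 * C ^ 2 = 256 * C ^ 2 * 1 * 1 * 1 := by ring
      _ ≤ 256 * C ^ 3 * CK * 9 ^ (m + 1) * ((m : ℝ) + 3) ^ (m + 3) := by gcongr
  · calc 128 * C * 9 ^ (m + 1) = 128 * C * 1 * 9 ^ (m + 1) * 1 := by ring
      _ ≤ 256 * C ^ 3 * CK * 9 ^ (m + 1) * ((m : ℝ) + 3) ^ (m + 3) := by gcongr; norm_num
  · calc 256 * C ^ 2 * ((m : ℝ) + 3) ^ (m + 3)
          = 256 * C ^ 2 * 1 * 1 * ((m : ℝ) + 3) ^ (m + 3) := by ring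
      _ ≤ 256 * C ^ 3 * CK * 9 ^ (m + 1) * ((m : ℝ) + 3) ^ (m + 3) := by gcongr

/-- **Term 1** (the model error at `z`): `(C_K/u) e^{s(Λ+γ)} ≤ t/(64 C e^{Λ r})`. -/
theorem pencilDisc_term1 {Λ r s t C CK : ℝ} {u : ℕ} (hC : 1 ≤ C) (hCK : 1 ≤ CK) (ht : 0 < t)
    (hΛ : 2 ≤ Λ) (hs : s ≤ r + 1 / (4 * Λ)) (hs' : s ≤ 3 / 5)
    (hE : Real.exp (2 * Λ * r) ≤ C ^ 2 * t) (hu : 192 * C ^ 3 * CK ≤ u) :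
    CK / u * Real.exp (s * (Λ + Real.eulerMascheroniConstant)) ≤
      t / (64 * C * Real.exp (Λ * r)) := by
  set γ := Real.eulerMascheroniConstant
  have hγ : γ < 2 / 3 := Real.eulerMascheroniConstant_lt_two_thirds
  have hγ0 : 0 < γ := lt_trans (by norm_num) Real.one_half_lt_eulerMascheroniConstant
  have hΛ0 : 0 < Λ := by linarith
  have hu0 : (0 : ℝ) < u := by
    have : (0 : ℝ) < 192 * C ^ 3 * CK := by positivity
    linarith
  set E := Real.exp (Λ * r) with hEdef
  have hE0 : 0 < E := Real.exp_pos _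
  have hE2 : E ^ 2 = Real.exp (2 * Λ * r) := by rw [sq, ← Real.exp_add]; ring_nf
  -- the exponent
  have h1 : s * Λ ≤ r * Λ + 1 / 4 := by
    have := mul_le_mul_of_nonneg_right hs hΛ0.le
    rwa [add_mul, div_mul_eq_mul_div, one_mul, mul_comm (4 : ℝ) Λ, ← div_div,
      div_self hΛ0.ne'] at this
  have h2 : s * γ ≤ 3 / 5 * γ := mul_le_mul_of_nonneg_right hs' hγ0.le
  have hexp : Real.exp (s * (Λ + γ)) ≤ 3 * E := by
    calc Real.exp (s * (Λ + γ)) ≤ Real.exp (Λ * r + 1) := Real.exp_le_exp.2 (by nlinarith)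
      _ = E * Real.exp 1 := by rw [Real.exp_add]
      _ ≤ E * 3 := mul_le_mul_of_nonneg_left (le_trans Real.exp_one_lt_d9.le (by norm_num)) hE0.le
      _ = 3 * E := mul_comm _ _
  rw [div_mul_eq_mul_div, div_le_div_iff₀ hu0 (by positivity)]
  calc CK * Real.exp (s * (Λ + γ)) * (64 * C * E) ≤ CK * (3 * E) * (64 * C * E) := by gcongr
    _ = 192 * C * CK * E ^ 2 := by ring
    _ ≤ 192 * C * CK * (C ^ 2 * t) := by rw [hE2]; gcongr
    _ = 192 * C ^ 3 * CK * t := by ring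
    _ ≤ u * t := mul_le_mul_of_nonneg_right hu ht.le
    _ = t * u := mul_comm _ _

/-- **Term 2** (the model error at `-z`): `t (C_K/u) e^{-s(Λ+γ)} ≤ t/(64 C e^{Λ r})`. -/
theorem pencilDisc_term2 {Λ r s t C CK : ℝ} {m u : ℕ} (hC : 1 ≤ C) (hCK : 1 ≤ CK) (ht : 0 < t)
    (hΛ : 2 ≤ Λ) (hs : r - 1 / (4 * Λ) ≤ s) (hs' : -(m : ℝ) - 1 / 2 ≤ s)
    (hu : 64 * C * CK * 3 ^ (m + 1) ≤ u) :
    t * (CK / u * Real.exp (-s * (Λ + Real.eulerMascheroniConstant))) ≤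
      t / (64 * C * Real.exp (Λ * r)) := by
  set γ := Real.eulerMascheroniConstant
  have hγ : γ < 2 / 3 := Real.eulerMascheroniConstant_lt_two_thirds
  have hγ0 : 0 < γ := lt_trans (by norm_num) Real.one_half_lt_eulerMascheroniConstant
  have hΛ0 : 0 < Λ := by linarith
  have hu0 : (0 : ℝ) < u := by
    have : (0 : ℝ) < 64 * C * CK * 3 ^ (m + 1) := by positivity
    linarith
  have hE0 : 0 < Real.exp (Λ * r) := Real.exp_pos _
  have h1 : -s * Λ ≤ -(Λ * r) + 1 / 4 := by
    have := mul_le_mul_of_nonneg_right hs hΛ0.le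
    rw [sub_mul, div_mul_eq_mul_div, one_mul, mul_comm (4 : ℝ) Λ, ← div_div,
      div_self hΛ0.ne'] at this
    linarith
  have h2 : -s * γ ≤ ((m : ℝ) + 1 / 2) * γ := mul_le_mul_of_nonneg_right (by linarith) hγ0.le
  have hm0 : (0 : ℝ) ≤ m := Nat.cast_nonneg m
  have hexp : Real.exp (-s * (Λ + γ)) ≤ (Real.exp (Λ * r))⁻¹ * 3 ^ (m + 1) := by
    calc Real.exp (-s * (Λ + γ)) ≤ Real.exp (-(Λ * r) + ((m + 1 : ℕ) : ℝ)) :=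
          Real.exp_le_exp.2 (by push_cast; nlinarith)
      _ = (Real.exp (Λ * r))⁻¹ * Real.exp 1 ^ (m + 1) := by
          rw [Real.exp_add, Real.exp_neg, Real.exp_one_pow]
      _ ≤ (Real.exp (Λ * r))⁻¹ * 3 ^ (m + 1) := by
          gcongr
          exact le_trans Real.exp_one_lt_d9.le (by norm_num)
  have key : CK / u * Real.exp (-s * (Λ + γ)) ≤ 1 / (64 * C * Real.exp (Λ * r)) := by
    rw [div_mul_eq_mul_div, div_le_div_iff₀ hu0 (by positivity)]
    calc CK * Real.exp (-s * (Λ + γ)) * (64 * C * Real.exp (Λ * r))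
        ≤ CK * ((Real.exp (Λ * r))⁻¹ * 3 ^ (m + 1)) * (64 * C * Real.exp (Λ * r)) := by
          gcongr
      _ = 64 * C * CK * 3 ^ (m + 1) * ((Real.exp (Λ * r))⁻¹ * Real.exp (Λ * r)) := by ring
      _ = 64 * C * CK * 3 ^ (m + 1) := by rw [inv_mul_cancel₀ hE0.ne', mul_one]
      _ ≤ u := hu
      _ = 1 * u := (one_mul _).symm
  calc t * (CK / u * Real.exp (-s * (Λ + γ))) ≤ t * (1 / (64 * C * Real.exp (Λ * r))) :=
        mul_le_mul_of_nonneg_left key ht.le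
    _ = t / (64 * C * Real.exp (Λ * r)) := by rw [mul_one_div]

/-- **Term 3a** (relative coefficient error): `u^{-(m+4)} e^{(|s|+2) log u} ≤ t/(128 C e^{Λ r})`. -/
theorem pencilDisc_term3a {Λ r s t C : ℝ} {m u : ℕ} (hC : 1 ≤ C) (ht : ((u : ℝ) ^ m)⁻¹ ≤ t)
    (hΛ : 2 ≤ Λ) (hs : r - 1 / (4 * Λ) ≤ s) (hs_lo : -(m : ℝ) - 1 / 2 ≤ s)
    (hs_hi : s ≤ 3 / 5)
    (hlog : Real.log u ≤ Λ + 7 / 5) (hE : Real.exp (Λ * r) ≤ 2 * C)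
    (hu1 : 256 * C ^ 2 ≤ u) (hu2 : 128 * C * 9 ^ (m + 1) ≤ u) :
    ((u : ℝ) ^ (m + 4))⁻¹ * Real.exp ((|s| + 2) * Real.log u) ≤
      t / (128 * C * Real.exp (Λ * r)) := by
  have hΛ0 : 0 < Λ := by linarith
  have hu1' : (1 : ℝ) ≤ u := by nlinarith
  have hu0 : (0 : ℝ) < u := by linarith
  have hL0 : 0 ≤ Real.log u := Real.log_nonneg hu1'
  have hE0 : 0 < Real.exp (Λ * r) := Real.exp_pos _
  have hsplit :
      Real.exp ((|s| + 2) * Real.log u) = Real.exp (|s| * Real.log u) * (u : ℝ) ^ 2 := by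
    rw [add_mul, Real.exp_add,
      show (2 : ℝ) * Real.log u = ((2 : ℕ) : ℝ) * Real.log u by norm_num, Real.exp_nat_mul,
      Real.exp_log hu0]
  rw [hsplit, le_div_iff₀ (by positivity)]
  rcases le_or_gt 0 s with hs0 | hs0
  · -- `s ≥ 0`: `e^{s log u} ≤ u`
    have h1 : Real.exp (|s| * Real.log u) ≤ u := by
      rw [abs_of_nonneg hs0]
      calc Real.exp (s * Real.log u) ≤ Real.exp (1 * Real.log u) :=
            Real.exp_le_exp.2 (mul_le_mul_of_nonneg_right (by linarith) hL0)
        _ = u := by rw [one_mul, Real.exp_log hu0]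
    calc ((u : ℝ) ^ (m + 4))⁻¹ * (Real.exp (|s| * Real.log u) * (u : ℝ) ^ 2) *
          (128 * C * Real.exp (Λ * r))
        ≤ ((u : ℝ) ^ (m + 4))⁻¹ * ((u : ℝ) * (u : ℝ) ^ 2) * (128 * C * (2 * C)) := by
          gcongr
      _ = (256 * C ^ 2) * (u : ℝ) ^ 3 / (u : ℝ) ^ (m + 4) := by ring
      _ ≤ u * (u : ℝ) ^ 3 / (u : ℝ) ^ (m + 4) := by gcongr
      _ = (u : ℝ) ^ 4 / (u : ℝ) ^ (m + 4) := by ring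
      _ = ((u : ℝ) ^ m)⁻¹ := by rw [pow_add]; field_simp
      _ ≤ t := ht
  · -- `s < 0`: `e^{-s log u} ≤ e^{-Λ r} 9^{m+1}`
    have hns : 0 ≤ -s := by linarith
    have h1 : -s * Λ ≤ -(Λ * r) + 1 / 4 := by
      have := mul_le_mul_of_nonneg_right hs hΛ0.le
      rw [sub_mul, div_mul_eq_mul_div, one_mul, mul_comm (4 : ℝ) Λ, ← div_div,
      div_self hΛ0.ne'] at this
      linarith
    have hm0 : (0 : ℝ) ≤ m := Nat.cast_nonneg m
    have h2 : -s * (7 / 5) ≤ ((m : ℝ) + 1 / 2) * (7 / 5) := by nlinarith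
    have hexp : Real.exp (|s| * Real.log u) ≤ (Real.exp (Λ * r))⁻¹ * 9 ^ (m + 1) := by
      rw [abs_of_neg hs0]
      calc Real.exp (-s * Real.log u) ≤ Real.exp (-s * (Λ + 7 / 5)) :=
            Real.exp_le_exp.2 (mul_le_mul_of_nonneg_left hlog hns)
        _ ≤ Real.exp (-(Λ * r) + ((2 * (m + 1) : ℕ) : ℝ)) :=
            Real.exp_le_exp.2 (by push_cast; nlinarith)
        _ = (Real.exp (Λ * r))⁻¹ * (Real.exp 1 ^ 2) ^ (m + 1) := by
            rw [Real.exp_add, Real.exp_neg, ← pow_mul, Real.exp_one_pow]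
        _ ≤ (Real.exp (Λ * r))⁻¹ * 9 ^ (m + 1) := by
            gcongr
            nlinarith [Real.exp_one_lt_d9, Real.exp_pos (1 : ℝ)]
    calc ((u : ℝ) ^ (m + 4))⁻¹ * (Real.exp (|s| * Real.log u) * (u : ℝ) ^ 2) *
          (128 * C * Real.exp (Λ * r))
        ≤ ((u : ℝ) ^ (m + 4))⁻¹ * (((Real.exp (Λ * r))⁻¹ * 9 ^ (m + 1)) * (u : ℝ) ^ 2) *
            (128 * C * Real.exp (Λ * r)) := by gcongr
      _ = (128 * C * 9 ^ (m + 1)) * (u : ℝ) ^ 2 / (u : ℝ) ^ (m + 4) *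
            ((Real.exp (Λ * r))⁻¹ * Real.exp (Λ * r)) := by ring
      _ = (128 * C * 9 ^ (m + 1)) * (u : ℝ) ^ 2 / (u : ℝ) ^ (m + 4) := by
          rw [inv_mul_cancel₀ hE0.ne', mul_one]
      _ ≤ u * (u : ℝ) ^ 2 / (u : ℝ) ^ (m + 4) := by gcongr
      _ = (u : ℝ) ^ 3 / (u : ℝ) ^ (m + 3 + 1) := by ring
      _ ≤ (u : ℝ) ^ 4 / (u : ℝ) ^ (m + 3 + 1) := by gcongr; norm_num
      _ = ((u : ℝ) ^ m)⁻¹ := by rw [pow_add, pow_add]; field_simp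
      _ ≤ t := ht

/-- **The floor ratio**: `(m+3)^u / u^u ≤ (m+3)^{m+3} / u^{m+3}` for `m + 3 ≤ u`. -/
theorem pencilDisc_ratio_pow_le (u m : ℕ) (hu : m + 3 ≤ u) :
    ((m : ℝ) + 3) ^ u / (u : ℝ) ^ u ≤ ((m : ℝ) + 3) ^ (m + 3) / (u : ℝ) ^ (m + 3) := by
  have hu0 : (0 : ℝ) < u := by
    have : (m + 3 : ℝ) ≤ u := by exact_mod_cast hu
    linarith
  have hq0 : 0 ≤ ((m : ℝ) + 3) / u := div_nonneg (by positivity) hu0.le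
  have hq1 : ((m : ℝ) + 3) / u ≤ 1 := by
    rw [div_le_one hu0]; exact_mod_cast hu
  rw [← div_pow, ← div_pow]
  exact pow_le_pow_of_le_one hq0 hq1 hu

/-- **Term 3b** (the floor): `u^{-u} · u (m+3)^u ≤ t/(128 C e^{Λ r})` for `u ≥ m+3`, `u ≥ 256 C² (m+3)^{m+3}`. -/
theorem pencilDisc_term3b {Λ r t C : ℝ} {m u : ℕ} (hC : 1 ≤ C) (ht : ((u : ℝ) ^ m)⁻¹ ≤ t)
    (hE : Real.exp (Λ * r) ≤ 2 * C) (hum : m + 3 ≤ u)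
    (hu : 256 * C ^ 2 * ((m : ℝ) + 3) ^ (m + 3) ≤ u) :
    ((u : ℝ) ^ u)⁻¹ * ((u : ℝ) * ((m : ℝ) + 3) ^ u) ≤
      t / (128 * C * Real.exp (Λ * r)) := by
  have hu3 : (3 : ℝ) ≤ u := by
    have : ((m + 3 : ℕ) : ℝ) ≤ u := by exact_mod_cast hum
    push_cast at this; linarith [(Nat.cast_nonneg m : (0 : ℝ) ≤ m)]
  have hu0 : (0 : ℝ) < u := by linarith
  have hE0 : 0 < Real.exp (Λ * r) := Real.exp_pos _
  have hratio := pencilDisc_ratio_pow_le u m hum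
  rw [le_div_iff₀ (by positivity)]
  calc ((u : ℝ) ^ u)⁻¹ * ((u : ℝ) * ((m : ℝ) + 3) ^ u) * (128 * C * Real.exp (Λ * r))
      = (u : ℝ) * (((m : ℝ) + 3) ^ u / (u : ℝ) ^ u) * (128 * C * Real.exp (Λ * r)) := by ring
    _ ≤ (u : ℝ) * (((m : ℝ) + 3) ^ (m + 3) / (u : ℝ) ^ (m + 3)) * (128 * C * (2 * C)) := by
        gcongr
    _ = (256 * C ^ 2 * ((m : ℝ) + 3) ^ (m + 3)) * u / (u : ℝ) ^ (m + 3) := by ring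
    _ ≤ u * u / (u : ℝ) ^ (m + 3) := by gcongr
    _ = (u : ℝ) ^ 2 / (u : ℝ) ^ (m + 2 + 1) := by ring
    _ ≤ (u : ℝ) ^ 3 / (u : ℝ) ^ (m + 2 + 1) := by gcongr <;> norm_num; linarith
    _ = ((u : ℝ) ^ m)⁻¹ := by rw [pow_add, pow_add]; field_simp
    _ ≤ t := ht

end Summit.Parity.GeneralizedHardyLittlewood.Cruxes.AbsoluteUpgrade.DipMarginRateExchange

end
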